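import Summits.AtomisticToContinuum.Crystallization.Theorems.PalmUnimodularRigidityMinimiserShellsSlackCertificatesA

/-!
# Slack certificates: the random-grid transport is a POINTWISE energy certificate
(line `octahedral-annulus-mandate` of crux `MinimiserShells`, stmt-AtomisticToContinuum-9225; part (i) of
stub `stub_capCertificates`)

Route `PalmUnimodularRigidity`, crux decl
`Summit.AtomisticToContinuum.Crystallization.Theses.PalmUnimodularRigidity.MinimiserShells`, lead
`prover-line-stmt-AtomisticToContinuum-9225-a1-0`.

**Theorem** (`stub_slackCertificates`).  For every hard core `δ > 0` and every slack `ε > 0` there are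
`R, M` and a transfer `t : (configuration, atom) → ℝ` which is jointly measurable, bounded by `M` and of
range `R`, such that for EVERY rooted `δ`-hard-core configuration `μ`
`e* − ε ≤ h(μ) + div t(μ)`, `div t(μ) = ∫ (t(μ, y) − t(θ_y μ, −y)) dμ(y)` (mass sent minus mass received,
`θ_y μ = μ.map (· − y)`), `h(μ) = ½ ∫ V_LJ(‖y‖) dμ` the root energy.

This is part (i) of the registered stub `stub_capCertificates` of the line (the universal slack-`ε`
certificate; part (ii) asks in addition for a margin `c > 0` at CAPLESS roots).  The line card derives (i)
abstractly from Sion's minimax theorem and the energy floor `e_uni ≥ e*` (item 9229); here it is proved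
CONSTRUCTIVELY: the random-grid mass transport of the landed proof of 9229
(`EnergyFloor.transport δ L`, files `…EnergyFloorDefs/A–E/EnergyFloor`) is itself a pointwise certificate.
With `t = −(vol [0,1)³)⁻¹ · transport` (truncated at its hard-core bound to make it bounded on all inputs):
mass received `≥ vol·(e* + C_δ)` by periodisation of the root's cluster (`le_lintegral_transport_map`),
mass sent `=` phase average of `local energy + C_δ` (`lintegral_transport_eq`)
`≤ vol·(h + C_δ) + err_L(μ)/12` (`setLIntegral_ofReal_locEnergy_le`), so `h + div t ≥ e* − err_L(μ)/(12·vol)`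
(`certificate_at`), and the uniform boundary error of part A (`errTerm_le_uniform`) is made `≤ 12·vol·ε` by
choosing the cut-off `ρ` and then the mesh `L`.  Consequence for the line: the certificate FORMAT of
`stub_capCertificates` (`IsTransfer` + `transferDiv`) is inhabited at slack `ε` for every `ε > 0`; what remains
open in that stub is only the cap margin `c > 0` (TCP-exclusion pricing).
-/

noncomputable section

open MeasureTheory Filter Set
open scoped ENNReal BigOperators Topology

namespace Summit.AtomisticToContinuum.Crystallization.Theorems.PalmUnimodularRigidityMinimiserShells.SlackCertificates

open Literature.Probability.Process (IsRootedHardCore IsPointStationaryLaw)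
open Literature.MathematicalPhysics.StatisticalMechanics (lennardJones rootEnergy)
open Summit.AtomisticToContinuum.Crystallization.Theorems.MinimiserShells.Negative.LoadBearing (eStar meanRootEnergy)
open Summit.AtomisticToContinuum.Crystallization.Theorems.MinimiserShells.Negative.Rootedness (E3 countable_of_separated)
open Summit.AtomisticToContinuum.Crystallization.Theorems.PalmUnimodularRigidityMinimiserShells.EnergyFloor

/-! ## The pointwise certificate at mesh `L` and cut-off `ρ` -/

/-- **The random-grid transport is a pointwise certificate.**  Fix `δ > 0`, a mesh `L > 0` and a cut-off
`ρ ≥ δ`; put `vol = vol [0,1)³`, `B = vol·(250/24·δ⁻¹² + C_δ)` and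
`U = 6(ρ/L)·250 δ⁻⁶ + vol·1000 δ⁻⁴ ρ⁻²` (the uniform boundary error of `errTerm_le_uniform`).  Then the
bounded finite-range transfer `t(μ, y) = −vol⁻¹ · min(transport δ L μ y, B)` satisfies, at EVERY rooted
`δ`-hard-core configuration, `e* − U/(12·vol) ≤ h(μ) + ∫ (t(μ,y) − t(θ_y μ, −y)) dμ(y)`. -/
theorem certificate_at {δ L ρ : ℝ} (hδ : 0 < δ) (hL : 0 < L) (hδρ : δ ≤ ρ) {μ : Measure E3}
    (hμ : IsRootedHardCore δ μ) :
    eStar - (6 * (ρ / L) * (250 * δ⁻¹ ^ 6) + (volume phaseDom).toReal * (1000 * δ⁻¹ ^ 4 * ρ⁻¹ ^ 2)) /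
        (12 * (volume phaseDom).toReal) ≤
      rootEnergy lennardJones μ +
        ∫ y, ((-(((volume phaseDom).toReal)⁻¹ *
                min (transport δ L μ y).toReal
                  ((volume phaseDom * ENNReal.ofReal (250 / 24 * δ⁻¹ ^ 12 + cst δ)).toReal))) -
              (-(((volume phaseDom).toReal)⁻¹ *
                min (transport δ L (Measure.map (fun z => z - y) μ) (-y)).toReal
                  ((volume phaseDom * ENNReal.ofReal (250 / 24 * δ⁻¹ ^ 12 + cst δ)).toReal)))) ∂μ := by
  -- names
  set D : ℝ≥0∞ := volume phaseDom with hD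
  set Bδ : ℝ≥0∞ := ENNReal.ofReal (250 / 24 * δ⁻¹ ^ 12 + cst δ) with hBδ
  set Mb : ℝ := (D * Bδ).toReal with hMb
  set d : ℝ := D.toReal with hd
  have hDne0 : D ≠ 0 := volume_phaseDom_ne_zero
  have hDtop : D ≠ ∞ := volume_phaseDom_ne_top
  have hdpos : 0 < d := ENNReal.toReal_pos hDne0 hDtop
  have hDBtop : D * Bδ ≠ ∞ := ENNReal.mul_ne_top hDtop ENNReal.ofReal_ne_top
  have hMb0 : 0 ≤ Mb := ENNReal.toReal_nonneg
  have hρ : 0 ≤ ρ := hδ.le.trans hδρ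
  -- the configuration
  have hμ' := hμ
  obtain ⟨S, h0, hsep, rfl⟩ := hμ
  set μ : Measure E3 := (Measure.count : Measure E3).restrict S with hμdef
  have hS : S.Countable := countable_of_separated hδ hsep
  have hSm : MeasurableSet S := hS.measurableSet
  have hmem : μ ∈ hcClass δ := mem_hcClass_of_hc hδ hμ'
  -- bounds on the transport, sent and received
  have hsent_le : ∀ y, transport δ L μ y ≤ D * Bδ := fun y => transport_le_of_hc hδ hμ' y
  have hrecv_le : ∀ y ∈ S, transport δ L (μ.map fun z => z - y) (-y) ≤ D * Bδ := fun y hy =>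
    transport_le_of_hc hδ (hμ'.map_sub ((Literature.Probability.Process.count_restrict_singleton_ne_zero_iff S y).2 hy)) _
  have hsent_zero : ∀ y : E3, 2 * L < ‖y‖ → transport δ L μ y = 0 := fun y hy =>
    transport_eq_zero_of_lt hL μ hy
  have hrecv_zero : ∀ y : E3, 2 * L < ‖y‖ → transport δ L (μ.map fun z => z - y) (-y) = 0 := fun y hy =>
    transport_eq_zero_of_lt hL _ (by rwa [norm_neg])
  -- the two real integrands
  set F₁ : E3 → ℝ := fun y => (transport δ L μ y).toReal with hF₁
  set F₂ : E3 → ℝ := fun y => (transport δ L (μ.map fun z => z - y) (-y)).toReal with hF₂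
  have hF₁m' : Measurable fun y : E3 => transport δ L μ y := by
    have h : Measurable ((Function.uncurry (transport δ L)) ∘ fun y : E3 => (μ, y)) :=
      (measurable_transport δ L).comp (measurable_const.prodMk measurable_id)
    rw [Function.comp_def] at h
    exact h
  have hF₁m : Measurable F₁ := hF₁m'.ennreal_toReal
  have hF₂m : Measurable F₂ := (measurable_transport_map_sub hmem).ennreal_toReal
  have hF₁le : ∀ y, F₁ y ≤ Mb := fun y => ENNReal.toReal_mono hDBtop (hsent_le y)
  have hF₂le : ∀ y ∈ S, F₂ y ≤ Mb := fun y hy => ENNReal.toReal_mono hDBtop (hrecv_le y hy)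
  have hF₁0 : ∀ y, 0 ≤ F₁ y := fun y => ENNReal.toReal_nonneg
  have hF₂0 : ∀ y, 0 ≤ F₂ y := fun y => ENNReal.toReal_nonneg
  -- the integrand is `d⁻¹ · (F₂ − F₁)` almost everywhere (on `S`)
  have hcongr : (fun y => (-(d⁻¹ * min (F₁ y) Mb)) - (-(d⁻¹ * min (F₂ y) Mb))) =ᵐ[μ]
      fun y => d⁻¹ * (F₂ y - F₁ y) := by
    refine (ae_restrict_iff' hSm).2 (Eventually.of_forall fun y hy => ?_)
    show -(d⁻¹ * min (F₁ y) Mb) - -(d⁻¹ * min (F₂ y) Mb) = d⁻¹ * (F₂ y - F₁ y)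
    rw [min_eq_left (hF₁le y), min_eq_left (hF₂le y hy)]
    ring
  -- integrability (bounded, supported in the ball of radius `2L`, which has finite mass)
  have hball : μ (Metric.closedBall (0 : E3) (2 * L)) ≠ ∞ :=
    (measure_lt_top_of_mem_hcClass hmem subset_rfl).ne
  have hg : Integrable ((Metric.closedBall (0 : E3) (2 * L)).indicator fun _ => Mb) μ :=
    (integrableOn_const hball).integrable_indicator measurableSet_closedBall
  have hbound₁ : ∀ᵐ y ∂μ, ‖F₁ y‖ ≤ (Metric.closedBall (0 : E3) (2 * L)).indicator (fun _ => Mb) y := by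
    refine Eventually.of_forall fun y => ?_
    by_cases hy : y ∈ Metric.closedBall (0 : E3) (2 * L)
    · rw [indicator_of_mem hy, Real.norm_eq_abs, abs_of_nonneg (hF₁0 y)]
      exact hF₁le y
    · rw [indicator_of_notMem hy, Real.norm_eq_abs, hF₁]
      rw [Metric.mem_closedBall, dist_zero_right, not_le] at hy
      simp [hsent_zero y hy]
  have hbound₂ : ∀ᵐ y ∂μ, ‖F₂ y‖ ≤ (Metric.closedBall (0 : E3) (2 * L)).indicator (fun _ => Mb) y := by
    refine (ae_restrict_iff' hSm).2 (Eventually.of_forall fun y hyS => ?_)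
    by_cases hy : y ∈ Metric.closedBall (0 : E3) (2 * L)
    · rw [indicator_of_mem hy, Real.norm_eq_abs, abs_of_nonneg (hF₂0 y)]
      exact hF₂le y hyS
    · rw [indicator_of_notMem hy, Real.norm_eq_abs, hF₂]
      rw [Metric.mem_closedBall, dist_zero_right, not_le] at hy
      simp [hrecv_zero y hy]
  have hF₁i : Integrable F₁ μ := hg.mono' hF₁m.aestronglyMeasurable hbound₁
  have hF₂i : Integrable F₂ μ := hg.mono' hF₂m.aestronglyMeasurable hbound₂
  -- the Bochner integrals are the `lintegral`s OUT and IN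
  have hOUT_eq : ∫ y, F₁ y ∂μ = (∫⁻ y, transport δ L μ y ∂μ).toReal :=
    integral_toReal hF₁m'.aemeasurable (Eventually.of_forall fun y => (hsent_le y).trans_lt hDBtop.lt_top)
  have hIN_eq : ∫ y, F₂ y ∂μ = (∫⁻ y, transport δ L (μ.map fun z => z - y) (-y) ∂μ).toReal :=
    integral_toReal (measurable_transport_map_sub hmem).aemeasurable
      ((ae_restrict_iff' hSm).2 (Eventually.of_forall fun y hy => (hrecv_le y hy).trans_lt hDBtop.lt_top))
  -- OUT and IN: the bounds of the energy-floor proof, and finiteness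
  set OUT : ℝ≥0∞ := ∫⁻ y, transport δ L μ y ∂μ with hOUTdef
  set IN : ℝ≥0∞ := ∫⁻ y, transport δ L (μ.map fun z => z - y) (-y) ∂μ with hINdef
  set U : ℝ≥0∞ := 6 * ENNReal.ofReal (ρ / L) * ENNReal.ofReal (250 * δ⁻¹ ^ 6) +
    D * ENNReal.ofReal (1000 * δ⁻¹ ^ 4 * ρ⁻¹ ^ 2) with hUdef
  have hUtop : U ≠ ∞ := by
    refine ENNReal.add_ne_top.2 ⟨?_, ENNReal.mul_ne_top hDtop ENNReal.ofReal_ne_top⟩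
    exact ENNReal.mul_ne_top (ENNReal.mul_ne_top (by norm_num) ENNReal.ofReal_ne_top) ENNReal.ofReal_ne_top
  have hIN : D * ENNReal.ofReal (eStar + cst δ) ≤ IN := le_lintegral_transport_map hδ hL hμ'
  have hOUT : OUT ≤ D * ENNReal.ofReal (rootEnergy' μ + cst δ) + ENNReal.ofReal (1 / 12) * U := by
    calc OUT = ∫⁻ v in phaseDom, ENNReal.ofReal (locEnergy δ μ (rootCell L v) + cst δ) :=
          lintegral_transport_eq hδ hL hμ'
      _ ≤ D * ENNReal.ofReal (rootEnergy' μ + cst δ) + ENNReal.ofReal (1 / 12) * errTerm L μ :=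
          setLIntegral_ofReal_locEnergy_le hδ L hμ'
      _ ≤ D * ENNReal.ofReal (rootEnergy' μ + cst δ) + ENNReal.ofReal (1 / 12) * U := by
          gcongr
          exact errTerm_le_uniform hδ hL hδρ hμ'
  have hRHS_top : D * ENNReal.ofReal (rootEnergy' μ + cst δ) + ENNReal.ofReal (1 / 12) * U ≠ ∞ :=
    ENNReal.add_ne_top.2 ⟨ENNReal.mul_ne_top hDtop ENNReal.ofReal_ne_top,
      ENNReal.mul_ne_top ENNReal.ofReal_ne_top hUtop⟩
  have hOUTtop : OUT ≠ ∞ := ne_top_of_le_ne_top hRHS_top hOUT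
  have hINtop : IN ≠ ∞ := by
    have hle : IN ≤ ∫⁻ y, (Metric.closedBall (0 : E3) (2 * L)).indicator (fun _ => D * Bδ) y ∂μ := by
      refine lintegral_mono_ae ((ae_restrict_iff' hSm).2 (Eventually.of_forall fun y hyS => ?_))
      by_cases hy : y ∈ Metric.closedBall (0 : E3) (2 * L)
      · rw [indicator_of_mem hy]
        exact hrecv_le y hyS
      · rw [indicator_of_notMem hy]
        rw [Metric.mem_closedBall, dist_zero_right, not_le] at hy
        rw [hrecv_zero y hy]
    rw [lintegral_indicator_const measurableSet_closedBall] at hle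
    exact ne_top_of_le_ne_top (ENNReal.mul_ne_top hDBtop hball) hle
  -- real-valued consequences
  have hh'C : 0 ≤ rootEnergy' μ + cst δ := by
    have := (rootEnergy'_bounds_of_hc hδ hμ').1
    unfold cst
    linarith
  have hOUTr : OUT.toReal ≤ d * (rootEnergy' μ + cst δ) + 1 / 12 * U.toReal := by
    have := ENNReal.toReal_mono hRHS_top hOUT
    rwa [ENNReal.toReal_add (ENNReal.mul_ne_top hDtop ENNReal.ofReal_ne_top)
      (ENNReal.mul_ne_top ENNReal.ofReal_ne_top hUtop), ENNReal.toReal_mul, ENNReal.toReal_mul,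
      ENNReal.toReal_ofReal hh'C, ENNReal.toReal_ofReal (by norm_num : (0 : ℝ) ≤ 1 / 12)] at this
  have hINr : d * (eStar + cst δ) ≤ IN.toReal := by
    have := ENNReal.toReal_mono hINtop hIN
    rw [ENNReal.toReal_mul, ENNReal.toReal_ofReal'] at this
    exact (mul_le_mul_of_nonneg_left (le_max_left _ _) hdpos.le).trans this
  have hUr : U.toReal = 6 * (ρ / L) * (250 * δ⁻¹ ^ 6) + d * (1000 * δ⁻¹ ^ 4 * ρ⁻¹ ^ 2) := by
    rw [hUdef, ENNReal.toReal_add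
      (ENNReal.mul_ne_top (ENNReal.mul_ne_top (by norm_num) ENNReal.ofReal_ne_top) ENNReal.ofReal_ne_top)
      (ENNReal.mul_ne_top hDtop ENNReal.ofReal_ne_top)]
    rw [ENNReal.toReal_mul, ENNReal.toReal_mul, ENNReal.toReal_mul,
      ENNReal.toReal_ofReal (div_nonneg hρ hL.le), ENNReal.toReal_ofReal (by positivity),
      ENNReal.toReal_ofReal (by positivity), ← hd]
    norm_num
  -- the root energy is the measurable root energy
  have hroot : rootEnergy lennardJones μ = rootEnergy' μ := by
    rw [Literature.MathematicalPhysics.StatisticalMechanics.rootEnergy_def, rootEnergy'_eq_of_hc hδ hμ']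
  -- assemble
  rw [integral_congr_ae hcongr, integral_const_mul, integral_sub hF₂i hF₁i, hOUT_eq, hIN_eq, hroot, ← hUr]
  have hkey : d * (eStar + cst δ) - (d * (rootEnergy' μ + cst δ) + 1 / 12 * U.toReal) ≤
      IN.toReal - OUT.toReal := by linarith
  have hd0 : d ≠ 0 := hdpos.ne'
  have hcalc : rootEnergy' μ + d⁻¹ * (d * (eStar + cst δ) - (d * (rootEnergy' μ + cst δ) + 1 / 12 * U.toReal)) =
      eStar - U.toReal / (12 * d) := by
    field_simp
    ring
  calc eStar - U.toReal / (12 * d)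
      = rootEnergy' μ + d⁻¹ * (d * (eStar + cst δ) - (d * (rootEnergy' μ + cst δ) + 1 / 12 * U.toReal)) :=
        hcalc.symm
    _ ≤ rootEnergy' μ + d⁻¹ * (IN.toReal - OUT.toReal) := by
        gcongr


/-! ## The slack certificates (part (i) of stub `stub_capCertificates`) -/

/-- **Slack certificates** (registered sub-goal `stub_slackCertificates` of line `octahedral-annulus-mandate`;
part (i) of its stub `stub_capCertificates`, with the line's `IsTransfer` / `transferDiv` unfolded).  For every
hard core `δ > 0` and slack `ε > 0` there are a range `R`, a bound `M` and a jointly measurable transfer `t`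
with `|t| ≤ M` and `t(μ, y) = 0` for `‖y‖ > R`, such that EVERY rooted `δ`-hard-core configuration satisfies
`e* − ε ≤ h(μ) + ∫ (t(μ, y) − t(θ_y μ, −y)) dμ(y)`.  Proof: `certificate_at` with the cut-off
`ρ = max δ (max 1 (1000 δ⁻⁴/(6ε)))` (tail `≤ 6ε·vol/12… `) and the mesh `L = (250ρδ⁻⁶ + vol·ε)/(vol·ε)`
(near field `≤ 6·vol·ε`), so that the uniform error is `≤ 12·vol·ε`. -/
theorem stub_slackCertificates : ∀ δ : ℝ, 0 < δ → ∀ ε : ℝ, 0 < ε → ∃ R M : ℝ, ∃ t : Measure E3 → E3 → ℝ, (Measurable (Function.uncurry t) ∧ (∀ μ y, |t μ y| ≤ M) ∧ ∀ μ y, R < ‖y‖ → t μ y = 0) ∧ ∀ μ : Measure E3, IsRootedHardCore δ μ → eStar - ε ≤ rootEnergy lennardJones μ + ∫ y, (t μ y - t (Measure.map (fun z => z - y) μ) (-y)) ∂μ := by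
  intro δ hδ ε hε
  -- the volume of the phase cube
  set D : ℝ≥0∞ := volume phaseDom with hD
  set d : ℝ := D.toReal with hd
  have hdpos : 0 < d := ENNReal.toReal_pos volume_phaseDom_ne_zero volume_phaseDom_ne_top
  -- the cut-off `ρ` and the mesh `L`
  set ρ : ℝ := max δ (max 1 (1000 * δ⁻¹ ^ 4 / (6 * ε))) with hρdef
  have hδρ : δ ≤ ρ := le_max_left _ _
  have hρ1 : 1 ≤ ρ := (le_max_left _ _).trans (le_max_right _ _)
  have hρA : 1000 * δ⁻¹ ^ 4 / (6 * ε) ≤ ρ := (le_max_right _ _).trans (le_max_right _ _)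
  have hρpos : 0 < ρ := one_pos.trans_le hρ1
  set L : ℝ := (250 * ρ * δ⁻¹ ^ 6 + d * ε) / (d * ε) with hLdef
  have hdε : 0 < d * ε := mul_pos hdpos hε
  have hLpos : 0 < L := div_pos (by positivity) hdε
  have hLmul : d * ε * L = 250 * ρ * δ⁻¹ ^ 6 + d * ε := by
    rw [hLdef, mul_div_cancel₀ _ hdε.ne']
  -- the uniform error is at most `12 · vol · ε`
  have htail : 1000 * δ⁻¹ ^ 4 * ρ⁻¹ ^ 2 ≤ 6 * ε := by
    have hρinv0 : 0 ≤ ρ⁻¹ := inv_nonneg.2 hρpos.le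
    have hρinv1 : ρ⁻¹ ≤ 1 := inv_le_one_of_one_le₀ hρ1
    have hsq : ρ⁻¹ ^ 2 ≤ ρ⁻¹ := pow_le_of_le_one hρinv0 hρinv1 two_ne_zero
    have hlin : 1000 * δ⁻¹ ^ 4 * ρ⁻¹ ≤ 6 * ε := by
      rw [div_le_iff₀ (by positivity)] at hρA
      rw [← div_eq_mul_inv, div_le_iff₀ hρpos]
      linarith
    calc 1000 * δ⁻¹ ^ 4 * ρ⁻¹ ^ 2 ≤ 1000 * δ⁻¹ ^ 4 * ρ⁻¹ :=
          mul_le_mul_of_nonneg_left hsq (by positivity)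
      _ ≤ 6 * ε := hlin
  have hnear : 6 * (ρ / L) * (250 * δ⁻¹ ^ 6) ≤ 6 * (d * ε) := by
    have h1 : 6 * (ρ / L) * (250 * δ⁻¹ ^ 6) = (1500 * ρ * δ⁻¹ ^ 6) / L := by
      field_simp
      norm_num
    rw [h1, div_le_iff₀ hLpos]
    nlinarith [hLmul, hdε]
  have herrε : (6 * (ρ / L) * (250 * δ⁻¹ ^ 6) + d * (1000 * δ⁻¹ ^ 4 * ρ⁻¹ ^ 2)) / (12 * d) ≤ ε := by
    rw [div_le_iff₀ (by positivity)]
    nlinarith [mul_le_mul_of_nonneg_left htail hdpos.le, hnear]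
  -- the transfer
  set Mb : ℝ := (volume phaseDom * ENNReal.ofReal (250 / 24 * δ⁻¹ ^ 12 + cst δ)).toReal with hMb
  have hMb0 : 0 ≤ Mb := ENNReal.toReal_nonneg
  refine ⟨2 * L, d⁻¹ * Mb,
    fun μ y => -(((volume phaseDom).toReal)⁻¹ * min (transport δ L μ y).toReal
      ((volume phaseDom * ENNReal.ofReal (250 / 24 * δ⁻¹ ^ 12 + cst δ)).toReal)),
    ⟨?_, ?_, ?_⟩, fun μ hμ => ?_⟩
  · -- jointly measurable
    have h : Measurable fun p : Measure E3 × E3 =>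
        -(((volume phaseDom).toReal)⁻¹ * min (Function.uncurry (transport δ L) p).toReal
          ((volume phaseDom * ENNReal.ofReal (250 / 24 * δ⁻¹ ^ 12 + cst δ)).toReal)) :=
      (((measurable_transport δ L).ennreal_toReal.min measurable_const).const_mul _).neg
    exact h
  · -- bounded
    intro μ y
    have hmin0 : 0 ≤ min (transport δ L μ y).toReal Mb := le_min ENNReal.toReal_nonneg hMb0
    have hmin1 : min (transport δ L μ y).toReal Mb ≤ Mb := min_le_right _ _
    show |-(((volume phaseDom).toReal)⁻¹ * min (transport δ L μ y).toReal
      ((volume phaseDom * ENNReal.ofReal (250 / 24 * δ⁻¹ ^ 12 + cst δ)).toReal))| ≤ d⁻¹ * Mb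
    rw [← hD, ← hd, ← hMb, abs_neg, abs_of_nonneg (mul_nonneg (inv_nonneg.2 hdpos.le) hmin0)]
    exact mul_le_mul_of_nonneg_left hmin1 (inv_nonneg.2 hdpos.le)
  · -- finite range
    intro μ y hy
    show -(((volume phaseDom).toReal)⁻¹ * min (transport δ L μ y).toReal
      ((volume phaseDom * ENNReal.ofReal (250 / 24 * δ⁻¹ ^ 12 + cst δ)).toReal)) = 0
    rw [transport_eq_zero_of_lt hLpos μ hy, ENNReal.toReal_zero, ← hMb, min_eq_left hMb0, mul_zero, neg_zero]
  · -- the certificate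
    have hc := certificate_at hδ hLpos hδρ hμ
    rw [← hD, ← hd] at hc
    linarith [hc, herrε]

end Summit.AtomisticToContinuum.Crystallization.Theorems.PalmUnimodularRigidityMinimiserShells.SlackCertificates

end
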